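import Literature.AlgebraicGeometry.Motives.GrassmannianChartAffine
import HarnessLib

/-!
# Rank-one charts of the Grassmannian: membership in a second chart and the transition rule

Topic `AlgebraicGeometry/Motives`; namespace `Literature.AlgebraicGeometry.Motives.Grassmannian`.  THEOREMS ONLY (no definition,
no instance, no notation, no named fact, no `sorry`).  Ring-side input (F4-1) of «`Gr(1, L)` is projective over `ℤ`» (cell hodgecm-mathlib,
(h4) / Plücker sub-hand F4): for the Grassmannian of RANK-ONE quotients `G(1, A ⊗_R M; A)` (Mathlib `Module.Grassmannian`) and one-element
frames `x y : Fin 1 → M`, a chart point `N ∈ chart x A` (★ `GrassmannianCharts`: the frame map `A → (A ⊗ M)⧸N`, `a ↦ a · [1 ⊗ x₀]`, is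
bijective) has the coordinate map `coordMap x N : M → A¹` (★ `GrassmannianChartAffine`, `m ↦` the unique `a` with `[1 ⊗ m] = a · [1 ⊗ x₀]`),
and the classical transition rules of projective space hold:

* `frameMap_apply_one`, `mkQ_one_tmul_eq_coordMap_smul` — `[1 ⊗ m] = (coordMap x N m)₀ · [1 ⊗ x₀]` in `(A ⊗ M)⧸N`;
* **`mem_chart_one_iff_isUnit_coordMap`** — `N ∈ chart y A ↔ (coordMap x N y₀)₀` is a unit («`x_j / x_i` invertible on `U_i ∩ U_j`»);
* **`coordMap_mul_coordMap`** — `(coordMap y N m)₀ · (coordMap x N y₀)₀ = (coordMap x N m)₀` («`(m/x_j) · (x_j/x_i) = m/x_i`»), with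
  `coordMap_frame_zero` (`(coordMap x N x₀)₀ = 1`) and `coordMap_mul_coordMap_frame` (`(x_i/x_j)(x_j/x_i) = 1`);
* `eq_of_coordMap_eq` — a chart point is determined by its coordinate map.

These are the cocycle identities of [Hartshorne1977, II Thm. 7.1 (proof)] / [GortzWedhorn2020, (8.4) (pp. 213–215)] for the ratios
`s_j/s_i` on the standard cover of `Gr(1, L) = ℙ(L)`.  Cell `hodgecm-mathlib` (D-0151), count-neutral Mathlib-side capital; nothing here is
about HC — HC_CM is proved only modulo the 7 printed citations until rung 0 closes.
-/

universe u v w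

open TensorProduct

namespace Literature.AlgebraicGeometry.Motives

namespace Grassmannian

variable {R : Type u} [CommRing R] {M : Type v} [AddCommGroup M] [Module R M]
variable {A : Type w} [CommRing A] [Algebra R A]

/-- In rank one the frame map at `x` is `a ↦ a₀ · [1 ⊗ x₀]`. [cite: GortzWedhorn2020, (8.4) (pp. 213–215)] -/
theorem frameMap_apply_one (x : Fin 1 → M) (N : Submodule A (A ⊗[R] M)) (a : Fin 1 → A) :
    frameMap x N a = a 0 • N.mkQ ((1 : A) ⊗ₜ[R] x 0) := by
  rw [frameMap_apply, Fin.sum_univ_one, ← map_smul, TensorProduct.smul_tmul', smul_eq_mul, mul_one]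

/-- **`[1 ⊗ m] = (coordMap x N m)₀ · [1 ⊗ x₀]`** in the rank-one quotient `(A ⊗ M)⧸N` for `N ∈ chart x A`.
[cite: GortzWedhorn2020, (8.4) (pp. 213–215)] [cite: StacksProject, Tag 089T] -/
theorem mkQ_one_tmul_eq_coordMap_smul (x : Fin 1 → M) (N : Module.Grassmannian A (A ⊗[R] M) 1) (hN : N ∈ chart R M 1 x A)
    (m : M) : N.toSubmodule.mkQ ((1 : A) ⊗ₜ[R] m) = coordMap x N hN m 0 • N.toSubmodule.mkQ ((1 : A) ⊗ₜ[R] x 0) := by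
  have h : frameEquiv x N hN (coordMap x N hN m) = N.toSubmodule.mkQ ((1 : A) ⊗ₜ[R] m) := by
    rw [coordMap_apply, LinearEquiv.apply_symm_apply]
  rw [← h, frameEquiv_apply, frameMap_apply_one]

/-- The coordinate of the frame vector itself is `1`: `(coordMap x N x₀)₀ = 1`. [cite: StacksProject, Tag 089T] -/
theorem coordMap_frame_zero (x : Fin 1 → M) (N : Module.Grassmannian A (A ⊗[R] M) 1) (hN : N ∈ chart R M 1 x A) :
    coordMap x N hN (x 0) 0 = 1 := by
  rw [coordMap_frame, Pi.single_eq_same]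

/-- In rank one the frame map at `y` is the frame map at `x` precomposed with multiplication by the coordinate
`c = (coordMap x N y₀)₀`: `frameMap y N a = frameMap x N (a₀ c)`. [cite: GortzWedhorn2020, (8.4) (pp. 213–215)] -/
theorem frameMap_one_eq_frameMap_mul (x y : Fin 1 → M) (N : Module.Grassmannian A (A ⊗[R] M) 1) (hx : N ∈ chart R M 1 x A)
    (a : Fin 1 → A) :
    frameMap y N.toSubmodule a = frameMap x N.toSubmodule (fun _ => a 0 * coordMap x N hx (y 0) 0) := by
  rw [frameMap_apply_one, frameMap_apply_one, mkQ_one_tmul_eq_coordMap_smul x N hx (y 0), smul_smul]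

/-- **Membership in a second rank-one chart**: for `N ∈ chart x A`, `N ∈ chart y A` iff the coordinate `(coordMap x N y₀)₀` is a
unit of `A` (the open `U_x ∩ U_y ⊆ U_x` is the non-vanishing locus of `y/x`). [cite: GortzWedhorn2020, (8.4) (pp. 213–215)]
[cite: StacksProject, Tag 089T] -/
theorem mem_chart_one_iff_isUnit_coordMap (x y : Fin 1 → M) (N : Module.Grassmannian A (A ⊗[R] M) 1)
    (hx : N ∈ chart R M 1 x A) : N ∈ chart R M 1 y A ↔ IsUnit (coordMap x N hx (y 0) 0) := by
  have hcomp : (frameMap y N.toSubmodule : (Fin 1 → A) → _) =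
      frameMap x N.toSubmodule ∘ fun a : Fin 1 → A => fun _ : Fin 1 => a 0 * coordMap x N hx (y 0) 0 :=
    funext (frameMap_one_eq_frameMap_mul x y N hx)
  have key : (fun a : Fin 1 → A => fun _ : Fin 1 => a 0 * coordMap x N hx (y 0) 0) =
      (Equiv.funUnique (Fin 1) A).symm ∘ (· * coordMap x N hx (y 0) 0) ∘ (Equiv.funUnique (Fin 1) A) := by
    funext a
    funext i
    simp only [Function.comp_apply, Equiv.funUnique_apply, Equiv.funUnique_symm_apply, Fin.default_eq_zero,
      uniqueElim_const]
  rw [mem_chart_iff, hcomp, Function.Bijective.of_comp_iff' hx, key, Equiv.comp_bijective, Equiv.bijective_comp,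
    IsUnit.isUnit_iff_mulRight_bijective]

/-- **The transition rule** for `N` in both charts: `(coordMap y N m)₀ · (coordMap x N y₀)₀ = (coordMap x N m)₀`
(«`(m/y)(y/x) = m/x`»). [cite: Hartshorne1977, II Thm. 7.1] [cite: GortzWedhorn2020, (8.4) (pp. 213–215)] -/
theorem coordMap_mul_coordMap (x y : Fin 1 → M) (N : Module.Grassmannian A (A ⊗[R] M) 1) (hx : N ∈ chart R M 1 x A)
    (hy : N ∈ chart R M 1 y A) (m : M) :
    coordMap y N hy m 0 * coordMap x N hx (y 0) 0 = coordMap x N hx m 0 := by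
  have h1 := mkQ_one_tmul_eq_coordMap_smul x N hx m
  have h2 := mkQ_one_tmul_eq_coordMap_smul y N hy m
  rw [mkQ_one_tmul_eq_coordMap_smul x N hx (y 0), smul_smul] at h2
  have h4 : frameMap x N.toSubmodule (fun _ => coordMap y N hy m 0 * coordMap x N hx (y 0) 0) =
      frameMap x N.toSubmodule (fun _ => coordMap x N hx m 0) := by
    rw [frameMap_apply_one, frameMap_apply_one, ← h2, ← h1]
  exact congrFun (hx.1 h4) 0

/-- The two transition coordinates are mutually inverse units: `(coordMap y N x₀)₀ · (coordMap x N y₀)₀ = 1`.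
[cite: Hartshorne1977, II Thm. 7.1] -/
theorem coordMap_mul_coordMap_frame (x y : Fin 1 → M) (N : Module.Grassmannian A (A ⊗[R] M) 1) (hx : N ∈ chart R M 1 x A)
    (hy : N ∈ chart R M 1 y A) : coordMap y N hy (x 0) 0 * coordMap x N hx (y 0) 0 = 1 := by
  rw [coordMap_mul_coordMap x y N hx hy (x 0), coordMap_frame_zero]

/-- **A chart point is determined by its coordinate map** (★ `ofCoordMap_coordMap`; any rank).
[cite: StacksProject, Tag 089T] -/
theorem eq_of_coordMap_eq {k : ℕ} (x : Fin k → M) (N N' : Module.Grassmannian A (A ⊗[R] M) k) (hN : N ∈ chart R M k x A)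
    (hN' : N' ∈ chart R M k x A) (h : coordMap x N hN = coordMap x N' hN') : N = N' := by
  rw [← ofCoordMap_coordMap x N hN, ← ofCoordMap_coordMap x N' hN']
  simp only [h]

end Grassmannian

end Literature.AlgebraicGeometry.Motives
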